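import Mathlib
import Summits.ABC.ABC.Theses.DefiniteXi
import Literature.NumberTheory.Automorphic.BrandtXi

/-!
# Sketch (crux-ideate, ideator 3) — first lemmas for the crux ideas on `XiStrongBound` (stmt-ABC-11337)

Card A `supersingular-unit-divisor`: ℓ¹–ℓ^∞ sandwich for `ξ` of a line (abstract Brandt layer, PROVED),
the prime-`N⁻` form of the crux, and the transfer `(Deg) ∧ (Sup)` stated over every Brandt setup.
Card B `dwork-tate-coordinate-complexity`: Dwork's integrality criterion for `exp(∑ bₙ Xⁿ/n)` (statement).
-/

namespace Summit.ABC.ABC.Cruxes.XiStrongBound.Ideator3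

open Literature.NumberTheory.Automorphic Literature.NumberTheory.EllipticCurves

/-- Card A, first lemma (PROVED): for a line `ℤ φ`, `ξ = Σ wᵢ φᵢ² ≤ (Σ wᵢ |φᵢ|) · max |φᵢ|` — the weighted
ℓ¹ norm (= `j_q⁻¹ ·` degree of the supersingular unit, up to the weights) times the sup norm. -/
theorem xi_le_l1_mul_linfty {ι : Type*} [Fintype ι] (w : ι → ℕ) {φ : ι → ℤ} (hφ : φ ≠ 0) (B : ℕ)
    (hB : ∀ i, (φ i).natAbs ≤ B) :
    Brandt.xi w (ℤ ∙ φ) ≤ (∑ i, w i * (φ i).natAbs) * B := by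
  rw [Brandt.xi_eq_sum w hφ rfl, Finset.sum_mul]
  refine Finset.sum_le_sum fun i _ => ?_
  rw [pow_two, ← mul_assoc]
  exact Nat.mul_le_mul_left _ (hB i)

/-- The prime-`N⁻` specialisation of the crux (all that `DefiniteGlue` consumes): `Nm = q` an odd prime. -/
def XiStrongBoundPrime : Prop :=
  ∀ ε : ℝ, 0 < ε → ∃ C : ℝ, ∀ a b : ℤ, IsCoprime a b → a * b * (a + b) ≠ 0 → ∀ (N : ℕ) [NeZero N],
    (freyCurve a b).conductorNorm ℤ = N → ∀ q : ℕ, q.Prime → q ≠ 2 → q ∣ N →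
      (brandtXi (N / q) q (fun n => (freyCurve a b).LFunction n) : ℝ) *
          ((((freyCurve a b).minimalDiscriminantNorm ℤ).factorization q : ℕ) : ℝ) ≤ C * (N : ℝ) ^ (2 + ε)

/-- The crux as filed implies its prime form (instantiate `Nm := q`). PROVED. -/
theorem xiStrongBoundPrime_of_crux (h : Summit.ABC.ABC.Theses.DefiniteXi.XiStrongBound) :
    XiStrongBoundPrime := by
  intro ε hε
  obtain ⟨C, hC⟩ := h ε hε
  refine ⟨C, fun a b hab h0 N _ hN q hq hq2 hqN => ?_⟩
  have hodd : Odd q := hq.odd_of_ne_two hq2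
  have key := hC a b hab h0 N hN q hodd hq.squarefree (by rw [Nat.Prime.primeFactors hq]; simp) hqN
  simpa [Nat.Prime.primeFactors hq] using key

/-- Card A, TRANSFER `C⁺ = (Deg) ∧ (Sup)`, stated over EVERY Brandt setup `S` of type `(N/q, q)` and every
generator `φ` of the `a(E)`-eigen-line (so no independence-of-choices is needed, cf. `brandtXi_le_of_forall`):
(Deg) the weighted ℓ¹-norm `Σ wᵢ|φᵢ|` (= `2·deg(g_E)/j_q` up to weights, `g_E` the supersingular unit whose
divisor is `j_q φ`) times `c_q = v_q(Δ_min)` is `≤ C N^{3/2+ε}`; (Sup) every value satisfies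
`φᵢ² · c_q ≤ C N^{1+ε}`. By `xi_le_l1_mul_linfty`, (Deg) ∧ (Sup) give `ξ(N/q,q)·c_q ≤ C' N^{2+2ε}`, i.e.
`XiStrongBoundPrime`; (Deg) alone gives `ξ c_q ≤ (Σ w|φ|)² c_q ≤ C² N^{3+2ε}` (polynomial rung). -/
def DegSupTransfer : Prop :=
  ∀ ε : ℝ, 0 < ε → ∃ C : ℝ, ∀ a b : ℤ, IsCoprime a b → a * b * (a + b) ≠ 0 → ∀ (N : ℕ) [NeZero N],
    (freyCurve a b).conductorNorm ℤ = N → ∀ q : ℕ, q.Prime → q ≠ 2 → q ∣ N →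
    ∀ (S : Brandt.XiSetup (N / q) q) [Fintype (Brandt.ClassSet S.O)] (φ : Brandt.ClassSet S.O → ℤ), φ ≠ 0 →
      Brandt.eigenLattice (N / q * q) (Brandt.matrix S.O) (fun n => (freyCurve a b).LFunction n) = ℤ ∙ φ →
      ((∑ i, Brandt.weight S.O i * (φ i).natAbs : ℕ) : ℝ) *
            ((((freyCurve a b).minimalDiscriminantNorm ℤ).factorization q : ℕ) : ℝ) ≤ C * (N : ℝ) ^ (3 / 2 + ε)
        ∧ ∀ i, (((φ i).natAbs ^ 2 : ℕ) : ℝ) *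
            ((((freyCurve a b).minimalDiscriminantNorm ℤ).factorization q : ℕ) : ℝ) ≤ C * (N : ℝ) ^ (1 + ε)

/-- The transfer target, as a proposition (to be proved by a crux-plan skeleton: unfold `brandtXi` to the
chosen setup, `xiOfOrder_eq`, case on whether the eigen-lattice is a line, `xi_le_l1_mul_linfty`). -/
def DegSupClosesPrime : Prop := DegSupTransfer → XiStrongBoundPrime

/-- Card B, first lemma (statement of Dwork's integrality criterion, the engine that makes the Tate
coordinate `u ∘ Φ = exp(∑ aₙ(E) qⁿ/n)` of the modular parametrisation a `q`-INTEGRAL series at a split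
multiplicative prime `q`): if `q^{k+1} ∣ b_{n q^{k+1}} − b_{n q^k}` for all `n ≥ 1, k ≥ 0`, then the
unique solution `g` of `n gₙ = Σ_{k=1}^{n} b_k g_{n−k}`, `g₀ = 1` (i.e. `G = exp(Σ bₙ Xⁿ/n)`) has
`q`-integral coefficients. For `b = a(E)`, `a_{mq} = a_m a_q` and `a_q = +1` give the hypothesis. -/
def DworkExpIntegral (q : ℕ) (b : ℕ → ℤ) : Prop :=
  (∀ n : ℕ, 0 < n → ∀ k : ℕ, (q : ℤ) ^ (k + 1) ∣ b (n * q ^ (k + 1)) - b (n * q ^ k)) →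
    ∀ g : ℕ → ℚ, g 0 = 1 → (∀ n : ℕ, 0 < n → (n : ℚ) * g n = ∑ k ∈ Finset.Icc 1 n, (b k : ℚ) * g (n - k)) →
      ∀ n, (g n).den.Coprime q

end Summit.ABC.ABC.Cruxes.XiStrongBound.Ideator3
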